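import Summits.BirchSwinnertonDyer.BirchSwinnertonDyer.Theorems.PrintCf2SplitBadTwoQuadraticSignCharacter
import Literature.NumberTheory.EllipticCurves.GreenbergVatsal2000.GreenbergSelmerGroups
import Literature.NumberTheory.GaloisRepresentations.ContinuousH1
import Mathlib.GroupTheory.DoubleCoset
import HarnessLib

/-!
# Crux `PrintCf2.SplitBadTwoRankOneOfFacts` (stmt-BirchSwinnertonDyer-20368), skeleton v13.5, registered stub (REG₂) `stub_xRegular_two`:
# TRANSPORT OF (LSₙ) ALONG A SIGN-TWISTED ISOMORPHISM OF COEFFICIENTS — `(LSₙ)(A) ⟹ (LSₙ)(A′)` for `e : A ≃+ A′` with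
# `e (σ • a) = χ(σ) • σ • e a`, `χ : Γ_K → {±1}` trivial on `U`

Cell `bsd-print-cf2`, EXTRA WIDTH seat `bsd-line-cf2-p1-w4` g14 (prover-bsd-line-cf2-p1-w4-g14-0); `--supports stmt-BirchSwinnertonDyer-20368`
(helper, Theses-free). HONEST FRAMING: nothing here closes the crux or a registered stub; BSD is not proved by any of this; no summit
statement is proved by this seat. No definition, no named fact, no `sorry`. Generic: any number field `K`, any normal `U ≤ Γ_K`, any
discrete `Γ_K`-modules `A, A′`, any place predicate `P`.

WHY (STATUS 2026-08-29T07:56:35Z, «B5-T ADDENDUM — case (B2) reduces to (B1) by a free re-twist»). The last brick of the fact-free R2 road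
to `stub_xRegular_two` (via -w2 g14 `XRegPinned.stub_xRegular_two_of_locSurjLayers`) is «B5-T», the twisted B5 at the `v̄`-place of the
layer field `F = K^{(v̄)}_n` for a quadratic `θ₀` whose sign character `ε` is `1` on `U ∩ D_𝔓(v̄)`, `U = Gal(K̄/F)`. Then `ε|_{D_v̄} ∈ {1, χ|_{D_v̄}}`
with `χ` the quadratic character of the `ℤ₂`-line (`F_w̃/K_v̄` is cyclic), and in the second case one RE-TWISTS `θ₀ ↦ θ₀·χ`: `χ|_U = 1`, so
`A_{θ₀}` and `A_{θ₀χ}` are the same `U`-module and (LSₙ) — local surjectivity modulo unramified classes over `U` — is insensitive to the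
re-twist. This file is that insensitivity, abstractly:

* **`locSurj_of_signEquiv`** — for `U ≤ Γ_K` normal, `χ : Γ_K →* ℤˣ` with `χ|_U = 1`, and an additive isomorphism `e : A ≃+ A′` of discrete
  `Γ_K`-modules with `e (σ • a) = χ(σ) • σ • e a` (so `e` is `U`-equivariant and `Γ_K`-equivariant up to the sign `χ`):
  `(LSₙ)(U, A, P) ⟹ (LSₙ)(U, A′, P)`, where `(LSₙ)(U, A, P)` is VERBATIM the `hLSn` body of p700059 `UpperBaseLift.locSurj_of_layers` / of
  `XRegPinned.stub_xRegular_two_of_locSurjLayers` for one layer (targets `τ w Q ∈ H¹(U ∩ D_w, A)` over the double cosets `Q ∈ D_w\Γ_K/U` at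
  the places `w ∈ T`, unramified conjugates at the places `w ∉ T` with `P w`). The converse is the same theorem for `e.symm`
  (`symm_smul_eq`).
* **`locSurj_charModule_of_unitChar_eq_on`** — the instance for character modules: `θ, θ′` quadratic framed characters (`θ² = θ′² = 1`) with
  `unitChar θ = unitChar θ′` ON `U` ⟹ `(LSₙ)(U, A_θ, P) ⟹ (LSₙ)(U, A_{θ′}, P)` (`χ := ε_θ·ε_{θ′}` the product of the sign characters of
  p706294 `KummerUDict.exists_signHom_of_sq_eq_one`, `e := charModuleEquiv θ ≫ (charModuleEquiv θ′)⁻¹`); e.g. `θ′ = θ ⊗ χ_{κ₂}` on the layers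
  `U = Gal(K̄/K^{(v̄)}_n)`, `n ≥ 1` (`XRegPinned.unitChar_twist`).
* the functoriality it rests on, all for the coefficient push `e_* = resH1Hom id e` on `H¹(U, ·)`, `H¹(U ∩ D_w, ·)`, `H¹(U ∩ I_w, ·)`:
  `e_*` commutes with restriction to `U ∩ D_w` / `U ∩ I_w` (`resH1Hom_decompInToH_comp_push`, `resOfLe_comp_push`, `resH1Hom_inertiaInToH_comp_push`),
  **`conjH1_push_eq_sign_smul`** — `conj_σ (e_* z) = χ(σ) • e_* (conj_σ z)` (explicit cocycles), `push_symm_push` / `push_push_symm` (`e_*` is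
  invertible), `mem_unramifiedKer_push_iff`.
presearch: functoriality of `H¹` in compatible pairs and the conjugation action — [SerreGaloisCohomology1997, I §2.4–§2.5],
[NeukirchSchmidtWingberg2008, I §5]; twisting by a character trivial on the subgroup — [GreenbergLNM1716, §4 p. 107 (`H¹(F_∞, A_s) = H¹(F_∞, A) ⊗ κ^s`)];
no new fact. beyond-print theorem: no.

References: [SerreGaloisCohomology1997] I §2.4, §2.5; [NeukirchSchmidtWingberg2008] I §5; [GreenbergLNM1716] §4 p. 107; [GreenbergVatsal2000] §2 p. 17.
-/

noncomputable section

open scoped Classical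

set_option linter.dupNamespace false
set_option autoImplicit false

open NumberField IsDedekindDomain Field
open Literature.NumberTheory.EllipticCurves Literature.NumberTheory.EllipticCurves.GreenbergSelmer
open Literature.NumberTheory.EllipticCurves.GreenbergVatsal2000 Literature.NumberTheory.EllipticCurves.KellerYin2024
open Literature.NumberTheory.GaloisRepresentations Literature.NumberTheory.IwasawaTheory

namespace Summit.BirchSwinnertonDyer.BirchSwinnertonDyer.Theorems.PrintCf2.SignTwist

variable {K : Type} [Field K] [NumberField K]
  {A : Type} [AddCommGroup A] [DistribMulAction (absoluteGaloisGroup K) A] [TopologicalSpace A] [DiscreteTopology A]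
  {A' : Type} [AddCommGroup A'] [DistribMulAction (absoluteGaloisGroup K) A'] [TopologicalSpace A'] [DiscreteTopology A']
  (χ : absoluteGaloisGroup K →* ℤˣ) (e : A ≃+ A')

/-! ## §1. Sign-twisted equivariance: elementary consequences -/

/-- `u • u • x = x` for a sign `u ∈ ℤˣ` (in any additive commutative group). [folklore] -/
theorem sign_smul_sign_smul {B : Type} [AddCommGroup B] (u : ℤˣ) (x : B) : (u : ℤ) • (u : ℤ) • x = x := by
  rw [← mul_zsmul, ← Units.val_mul, Int.units_mul_self, Units.val_one, one_zsmul]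

omit [NumberField K] [TopologicalSpace A] [DiscreteTopology A] [TopologicalSpace A'] [DiscreteTopology A'] in
/-- From `e (σ • a) = χ(σ) • σ • e a`: `σ • e a = χ(σ) • e (σ • a)`. [folklore] -/
theorem smul_map_eq (he : ∀ (σ : absoluteGaloisGroup K) (a : A), e (σ • a) = ((χ σ : ℤˣ) : ℤ) • σ • e a)
    (σ : absoluteGaloisGroup K) (a : A) : σ • e a = ((χ σ : ℤˣ) : ℤ) • e (σ • a) := by
  rw [he, sign_smul_sign_smul]

omit [NumberField K] [TopologicalSpace A] [DiscreteTopology A] [TopologicalSpace A'] [DiscreteTopology A'] in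
/-- The inverse isomorphism is sign-twisted equivariant for the same sign: `e⁻¹ (σ • a′) = χ(σ) • σ • e⁻¹ a′`. [folklore] -/
theorem symm_smul_eq (he : ∀ (σ : absoluteGaloisGroup K) (a : A), e (σ • a) = ((χ σ : ℤˣ) : ℤ) • σ • e a)
    (σ : absoluteGaloisGroup K) (a' : A') : e.symm (σ • a') = ((χ σ : ℤˣ) : ℤ) • σ • e.symm a' := by
  apply e.injective
  rw [e.apply_symm_apply, _root_.map_zsmul, he, sign_smul_sign_smul, e.apply_symm_apply]

omit [NumberField K] [TopologicalSpace A] [DiscreteTopology A] [TopologicalSpace A'] [DiscreteTopology A'] in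
/-- On the subgroup where `χ = 1` the isomorphism is equivariant: `e (u • a) = u • e a`. [folklore] -/
theorem map_smul_of_sign_eq_one (he : ∀ (σ : absoluteGaloisGroup K) (a : A), e (σ • a) = ((χ σ : ℤˣ) : ℤ) • σ • e a)
    {u : absoluteGaloisGroup K} (hu : χ u = 1) (a : A) : e (u • a) = u • e a := by
  rw [he, hu, Units.val_one, one_zsmul]

/-! ## §2. The coefficient push `e_*` on `H¹` of a subgroup and its functoriality -/

section Push

variable {G : Type} [Group G] [TopologicalSpace G] [IsTopologicalGroup G]
  {M : Type} [AddCommGroup M] [DistribMulAction G M] [TopologicalSpace M] [DiscreteTopology M]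
  {M' : Type} [AddCommGroup M'] [DistribMulAction G M'] [TopologicalSpace M'] [DiscreteTopology M']

/-- **`e⁻¹_* ∘ e_* = id`** on `H¹(G, M)` for an equivariant additive isomorphism `e`. [cite: SerreGaloisCohomology1997, I §2.4] -/
theorem push_symm_push (f : M ≃+ M') (hf : ∀ (x : G) (m : M), f.toAddMonoidHom (ContinuousMonoidHom.id G x • m) = x • f.toAddMonoidHom m)
    (hf' : ∀ (x : G) (m : M'), f.symm.toAddMonoidHom (ContinuousMonoidHom.id G x • m) = x • f.symm.toAddMonoidHom m)
    (z : discreteH1 G M) :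
    resH1Hom (ContinuousMonoidHom.id G) f.symm.toAddMonoidHom hf' (resH1Hom (ContinuousMonoidHom.id G) f.toAddMonoidHom hf z) = z := by
  rw [← AddMonoidHom.comp_apply, resH1Hom_comp]
  have h : resH1Hom ((ContinuousMonoidHom.id G).comp (ContinuousMonoidHom.id G)) (f.symm.toAddMonoidHom.comp f.toAddMonoidHom)
      (fun x m ↦ by simp) = resH1Hom (ContinuousMonoidHom.id G) (AddMonoidHom.id M) (fun _ _ ↦ rfl) :=
    resH1Hom_congr (ContinuousMonoidHom.ext fun _ ↦ rfl) (AddMonoidHom.ext fun m ↦ f.symm_apply_apply m) _ _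
  rw [h, resH1Hom_id, AddMonoidHom.id_apply]

/-- **`e_* ∘ e⁻¹_* = id`** on `H¹(G, M′)`. [cite: SerreGaloisCohomology1997, I §2.4] -/
theorem push_push_symm (f : M ≃+ M') (hf : ∀ (x : G) (m : M), f.toAddMonoidHom (ContinuousMonoidHom.id G x • m) = x • f.toAddMonoidHom m)
    (hf' : ∀ (x : G) (m : M'), f.symm.toAddMonoidHom (ContinuousMonoidHom.id G x • m) = x • f.symm.toAddMonoidHom m)
    (z : discreteH1 G M') :
    resH1Hom (ContinuousMonoidHom.id G) f.toAddMonoidHom hf (resH1Hom (ContinuousMonoidHom.id G) f.symm.toAddMonoidHom hf' z) = z :=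
  push_symm_push f.symm hf' hf z

/-- **`e_*` is injective** for an equivariant additive isomorphism `e`. [cite: SerreGaloisCohomology1997, I §2.4] -/
theorem push_injective (f : M ≃+ M') (hf : ∀ (x : G) (m : M), f.toAddMonoidHom (ContinuousMonoidHom.id G x • m) = x • f.toAddMonoidHom m)
    (hf' : ∀ (x : G) (m : M'), f.symm.toAddMonoidHom (ContinuousMonoidHom.id G x • m) = x • f.symm.toAddMonoidHom m) :
    Function.Injective (resH1Hom (ContinuousMonoidHom.id G) f.toAddMonoidHom hf) :=
  Function.LeftInverse.injective (g := resH1Hom (ContinuousMonoidHom.id G) f.symm.toAddMonoidHom hf') (push_symm_push f hf hf')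

variable {G' : Type} [Group G'] [TopologicalSpace G'] [IsTopologicalGroup G']
  {N : Type} [AddCommGroup N] [DistribMulAction G' N] [TopologicalSpace N] [DiscreteTopology N]
  {N' : Type} [AddCommGroup N'] [DistribMulAction G' N'] [TopologicalSpace N'] [DiscreteTopology N']

/-- **Restriction along a group map commutes with a coefficient push**: for `θ : G′ → G`, coefficient maps `ψ : M → M′` (over `G`),
`ψ′ : N → N′` (over `G′`) and change-of-group maps `r : M → N`, `r′ : M′ → N′` along `θ` with `r′ ∘ ψ = ψ′ ∘ r`:
`res_(θ,r′) ∘ ψ_* = ψ′_* ∘ res_(θ,r)` (both are the map of one compatible pair). [cite: SerreGaloisCohomology1997, I §2.4] -/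
theorem resH1Hom_comp_push (θ : G' →ₜ* G) (ψ : M →+ M') (hψ : ∀ (x : G) (m : M), ψ (ContinuousMonoidHom.id G x • m) = x • ψ m)
    (ψ' : N →+ N') (hψ' : ∀ (x : G') (m : N), ψ' (ContinuousMonoidHom.id G' x • m) = x • ψ' m)
    (r : M →+ N) (hr : ∀ (x : G') (m : M), r (θ x • m) = x • r m) (r' : M' →+ N') (hr' : ∀ (x : G') (m : M'), r' (θ x • m) = x • r' m)
    (hsq : ∀ m : M, r' (ψ m) = ψ' (r m)) :
    (resH1Hom θ r' hr').comp (resH1Hom (ContinuousMonoidHom.id G) ψ hψ) = (resH1Hom (ContinuousMonoidHom.id G') ψ' hψ').comp (resH1Hom θ r hr) := by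
  rw [resH1Hom_comp, resH1Hom_comp]
  exact resH1Hom_congr (ContinuousMonoidHom.ext fun _ ↦ rfl) (AddMonoidHom.ext fun m ↦ hsq m) _ _

end Push

/-! ## §3. The pushes on `H¹(U, ·)`, `H¹(U ∩ D_w, ·)`, `H¹(U ∩ I_w, ·)` and conjugation -/

section Subgroups

variable (U : Subgroup (absoluteGaloisGroup K))

omit [NumberField K] [TopologicalSpace A] [DiscreteTopology A] [TopologicalSpace A'] [DiscreteTopology A'] in
/-- `e` is `U`-equivariant when `χ|_U = 1` (compatibility datum of `e_*` on `H¹(U, ·)`). [folklore] -/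
theorem compat_U (he : ∀ (σ : absoluteGaloisGroup K) (a : A), e (σ • a) = ((χ σ : ℤˣ) : ℤ) • σ • e a) (hχU : ∀ u ∈ U, χ u = 1)
    (x : U) (a : A) : e.toAddMonoidHom (ContinuousMonoidHom.id U x • a) = x • e.toAddMonoidHom a :=
  map_smul_of_sign_eq_one χ e he (hχU x x.2) a

omit [NumberField K] [TopologicalSpace A] [DiscreteTopology A] [TopologicalSpace A'] [DiscreteTopology A'] in
/-- `e⁻¹` is `U`-equivariant when `χ|_U = 1`. [folklore] -/
theorem compat_U_symm (he : ∀ (σ : absoluteGaloisGroup K) (a : A), e (σ • a) = ((χ σ : ℤˣ) : ℤ) • σ • e a) (hχU : ∀ u ∈ U, χ u = 1)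
    (x : U) (a' : A') : e.symm.toAddMonoidHom (ContinuousMonoidHom.id U x • a') = x • e.symm.toAddMonoidHom a' :=
  map_smul_of_sign_eq_one χ e.symm (symm_smul_eq χ e he) (hχU x x.2) a'

omit [TopologicalSpace A] [DiscreteTopology A] [TopologicalSpace A'] [DiscreteTopology A'] in
/-- `e` is `U ∩ D_w`-equivariant when `χ|_U = 1`. [folklore] -/
theorem compat_decompIn (he : ∀ (σ : absoluteGaloisGroup K) (a : A), e (σ • a) = ((χ σ : ℤˣ) : ℤ) • σ • e a) (hχU : ∀ u ∈ U, χ u = 1)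
    (w : HeightOneSpectrum (𝓞 K)) (x : decompIn U w) (a : A) :
    e.toAddMonoidHom (ContinuousMonoidHom.id (decompIn U w) x • a) = x • e.toAddMonoidHom a :=
  map_smul_of_sign_eq_one χ e he (hχU _ ((mem_decompIn_iff U w x).1 x.2)) a

omit [TopologicalSpace A] [DiscreteTopology A] [TopologicalSpace A'] [DiscreteTopology A'] in
/-- `e⁻¹` is `U ∩ D_w`-equivariant when `χ|_U = 1`. [folklore] -/
theorem compat_decompIn_symm (he : ∀ (σ : absoluteGaloisGroup K) (a : A), e (σ • a) = ((χ σ : ℤˣ) : ℤ) • σ • e a) (hχU : ∀ u ∈ U, χ u = 1)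
    (w : HeightOneSpectrum (𝓞 K)) (x : decompIn U w) (a' : A') :
    e.symm.toAddMonoidHom (ContinuousMonoidHom.id (decompIn U w) x • a') = x • e.symm.toAddMonoidHom a' :=
  map_smul_of_sign_eq_one χ e.symm (symm_smul_eq χ e he) (hχU _ ((mem_decompIn_iff U w x).1 x.2)) a'

omit [TopologicalSpace A] [DiscreteTopology A] [TopologicalSpace A'] [DiscreteTopology A'] in
/-- `e` is `U ∩ I_w`-equivariant when `χ|_U = 1`. [folklore] -/
theorem compat_inertiaIn (he : ∀ (σ : absoluteGaloisGroup K) (a : A), e (σ • a) = ((χ σ : ℤˣ) : ℤ) • σ • e a) (hχU : ∀ u ∈ U, χ u = 1)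
    (w : HeightOneSpectrum (𝓞 K)) (x : inertiaIn U w) (a : A) :
    e.toAddMonoidHom (ContinuousMonoidHom.id (inertiaIn U w) x • a) = x • e.toAddMonoidHom a :=
  map_smul_of_sign_eq_one χ e he (hχU _ ((mem_inertiaIn_iff U w x).1 x.2).1) a

omit [TopologicalSpace A] [DiscreteTopology A] [TopologicalSpace A'] [DiscreteTopology A'] in
/-- `e⁻¹` is `U ∩ I_w`-equivariant when `χ|_U = 1`. [folklore] -/
theorem compat_inertiaIn_symm (he : ∀ (σ : absoluteGaloisGroup K) (a : A), e (σ • a) = ((χ σ : ℤˣ) : ℤ) • σ • e a) (hχU : ∀ u ∈ U, χ u = 1)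
    (w : HeightOneSpectrum (𝓞 K)) (x : inertiaIn U w) (a' : A') :
    e.symm.toAddMonoidHom (ContinuousMonoidHom.id (inertiaIn U w) x • a') = x • e.symm.toAddMonoidHom a' :=
  map_smul_of_sign_eq_one χ e.symm (symm_smul_eq χ e he) (hχU _ ((mem_inertiaIn_iff U w x).1 x.2).1) a'

/-- **Restriction to `U ∩ D_w` commutes with `e_*`.** [cite: SerreGaloisCohomology1997, I §2.4] -/
theorem resH1Hom_decompInToH_push (he : ∀ (σ : absoluteGaloisGroup K) (a : A), e (σ • a) = ((χ σ : ℤˣ) : ℤ) • σ • e a)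
    (hχU : ∀ u ∈ U, χ u = 1) (w : HeightOneSpectrum (𝓞 K)) (z : subgroupH1 U A) :
    resH1Hom (decompInToH U w) (AddMonoidHom.id A') (fun _ _ ↦ rfl)
        (resH1Hom (ContinuousMonoidHom.id U) e.toAddMonoidHom (compat_U χ e U he hχU) z) =
      resH1Hom (ContinuousMonoidHom.id (decompIn U w)) e.toAddMonoidHom (compat_decompIn χ e U he hχU w)
        (resH1Hom (decompInToH U w) (AddMonoidHom.id A) (fun _ _ ↦ rfl) z) := by
  rw [← AddMonoidHom.comp_apply, resH1Hom_comp_push (decompInToH U w) e.toAddMonoidHom (compat_U χ e U he hχU) e.toAddMonoidHom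
    (compat_decompIn χ e U he hχU w) (AddMonoidHom.id A) (fun _ _ ↦ rfl) (AddMonoidHom.id A') (fun _ _ ↦ rfl) (fun _ ↦ rfl),
    AddMonoidHom.comp_apply]

/-- **Restriction `U ∩ D_w → U ∩ I_w` commutes with `e_*`.** [cite: SerreGaloisCohomology1997, I §2.4] -/
theorem resOfLe_push (he : ∀ (σ : absoluteGaloisGroup K) (a : A), e (σ • a) = ((χ σ : ℤˣ) : ℤ) • σ • e a)
    (hχU : ∀ u ∈ U, χ u = 1) (w : HeightOneSpectrum (𝓞 K)) (c : subgroupH1 (decompIn U w) A) :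
    resOfLe A' (inertiaIn_le_decompIn U w)
        (resH1Hom (ContinuousMonoidHom.id (decompIn U w)) e.toAddMonoidHom (compat_decompIn χ e U he hχU w) c) =
      resH1Hom (ContinuousMonoidHom.id (inertiaIn U w)) e.toAddMonoidHom (compat_inertiaIn χ e U he hχU w)
        (resOfLe A (inertiaIn_le_decompIn U w) c) := by
  rw [resOfLe, resOfLe, ← AddMonoidHom.comp_apply, resH1Hom_comp_push (subgroupInclusion (inertiaIn_le_decompIn U w)) e.toAddMonoidHom
    (compat_decompIn χ e U he hχU w) e.toAddMonoidHom (compat_inertiaIn χ e U he hχU w) (AddMonoidHom.id A) (fun _ _ ↦ rfl)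
    (AddMonoidHom.id A') (fun _ _ ↦ rfl) (fun _ ↦ rfl), AddMonoidHom.comp_apply]

/-- **Restriction to `U ∩ I_w` commutes with `e_*`.** [cite: SerreGaloisCohomology1997, I §2.4] -/
theorem resH1Hom_inertiaInToH_push (he : ∀ (σ : absoluteGaloisGroup K) (a : A), e (σ • a) = ((χ σ : ℤˣ) : ℤ) • σ • e a)
    (hχU : ∀ u ∈ U, χ u = 1) (w : HeightOneSpectrum (𝓞 K)) (z : subgroupH1 U A) :
    resH1Hom (inertiaInToH U w) (AddMonoidHom.id A') (fun _ _ ↦ rfl)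
        (resH1Hom (ContinuousMonoidHom.id U) e.toAddMonoidHom (compat_U χ e U he hχU) z) =
      resH1Hom (ContinuousMonoidHom.id (inertiaIn U w)) e.toAddMonoidHom (compat_inertiaIn χ e U he hχU w)
        (resH1Hom (inertiaInToH U w) (AddMonoidHom.id A) (fun _ _ ↦ rfl) z) := by
  rw [← AddMonoidHom.comp_apply, resH1Hom_comp_push (inertiaInToH U w) e.toAddMonoidHom (compat_U χ e U he hχU) e.toAddMonoidHom
    (compat_inertiaIn χ e U he hχU w) (AddMonoidHom.id A) (fun _ _ ↦ rfl) (AddMonoidHom.id A') (fun _ _ ↦ rfl) (fun _ ↦ rfl),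
    AddMonoidHom.comp_apply]

/-- **`e_*` preserves and reflects unramified classes**: `z ∈ H¹_ur ⟺ e_* z ∈ H¹_ur` at every finite place. [cite: GreenbergVatsal2000, §2 p. 17] -/
theorem mem_unramifiedKer_push_iff (he : ∀ (σ : absoluteGaloisGroup K) (a : A), e (σ • a) = ((χ σ : ℤˣ) : ℤ) • σ • e a)
    (hχU : ∀ u ∈ U, χ u = 1) (w : HeightOneSpectrum (𝓞 K)) (z : subgroupH1 U A) :
    resH1Hom (ContinuousMonoidHom.id U) e.toAddMonoidHom (compat_U χ e U he hχU) z ∈ unramifiedKer U A' w ↔ z ∈ unramifiedKer U A w := by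
  rw [unramifiedKer, unramifiedKer, AddMonoidHom.mem_ker, AddMonoidHom.mem_ker, resH1Hom_inertiaInToH_push χ e U he hχU w z]
  constructor
  · intro h
    exact push_injective e (compat_inertiaIn χ e U he hχU w) (compat_inertiaIn_symm χ e U he hχU w) (by rw [h, map_zero])
  · intro h
    rw [h, map_zero]

variable [U.Normal]

omit [NumberField K] in
/-- **Conjugation versus the push, with the sign**: `conj_σ (e_* z) = χ(σ) • e_* (conj_σ z)` in `H¹(U, A′)` — on cocycles both sides are
`h ↦ σ • e (φ(σ⁻¹ h σ)) = χ(σ) • e (σ • φ(σ⁻¹ h σ))`. [cite: SerreGaloisCohomology1997, I §2.5] [cite: GreenbergLNM1716, §4 p. 107] -/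
theorem conjH1_push_eq_sign_smul (he : ∀ (σ : absoluteGaloisGroup K) (a : A), e (σ • a) = ((χ σ : ℤˣ) : ℤ) • σ • e a)
    (hχU : ∀ u ∈ U, χ u = 1) (σ : absoluteGaloisGroup K) (z : subgroupH1 U A) :
    conjH1 U A' σ (resH1Hom (ContinuousMonoidHom.id U) e.toAddMonoidHom (compat_U χ e U he hχU) z) =
      ((χ σ : ℤˣ) : ℤ) • resH1Hom (ContinuousMonoidHom.id U) e.toAddMonoidHom (compat_U χ e U he hχU) (conjH1 U A σ z) := by
  obtain ⟨f, rfl⟩ := oneCocycleClass_surjective _ z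
  have hval : ∀ a : A, σ • e a = ((χ σ : ℤˣ) : ℤ) • e (σ • a) := smul_map_eq χ e he σ
  rw [conjH1, conjH1]
  erw [map_oneCocycleClass, map_oneCocycleClass, map_oneCocycleClass, map_oneCocycleClass]
  rcases Int.units_eq_one_or (χ σ) with h | h
  · rw [h, Units.val_one, one_zsmul]
    simp_rw [h, Units.val_one, one_zsmul] at hval
    congr 1
    exact Subtype.ext (ContinuousMap.ext fun x ↦ hval _)
  · rw [h, Units.val_neg, Units.val_one, neg_one_zsmul]
    simp_rw [h, Units.val_neg, Units.val_one, neg_one_zsmul] at hval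
    rw [eq_neg_iff_add_eq_zero, ← oneCocycleClass_add, ← oneCocycleClass_zero]
    congr 1
    refine Subtype.ext (ContinuousMap.ext fun x ↦ ?_)
    simp only [Submodule.coe_add, ContinuousMap.add_apply, Submodule.coe_zero, ContinuousMap.zero_apply]
    exact (hval _ ▸ neg_add_cancel _ : σ • e (f.1 _) + e (σ • f.1 _) = 0)

end Subgroups

/-! ## §4. The transport theorem -/

/-- **(LSₙ) is insensitive to a sign re-twist of the coefficients.** For `U ≤ Γ_K` normal, `χ : Γ_K →* ℤˣ` with `χ|_U = 1`, an additive
isomorphism `e : A ≃+ A′` of discrete `Γ_K`-modules with `e (σ • a) = χ(σ) • σ • e a`, and any place predicate `P`: local surjectivity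
modulo unramified classes over `U` for `A` (targets at the places of `T`, unramified conjugates at the places `w ∉ T` with `P w` — VERBATIM
the per-layer `hLSn` body of `UpperBaseLift.locSurj_of_layers` / `XRegPinned.stub_xRegular_two_of_locSurjLayers`) implies the same for
`A′`: given targets `τ′` for `A′`, solve for the targets `e⁻¹_* (χ(Q.out) • τ′ w Q)` in `A` and push the solution by `e_*`; conjugates pick
up the sign `χ(Q.out) = ±1` (`conjH1_push_eq_sign_smul`), which cancels against the one put into the targets and is invisible to the kernels.
Use: `A = A_{θ₀}`, `A′ = A_{θ₀χ}` for a quadratic `χ` trivial on the layer group `U` (re-twist step of «B5-T», case (B2) → (B1)).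
[cite: GreenbergLNM1716, §4 p. 107] [cite: SerreGaloisCohomology1997, I §2.5] -/
theorem locSurj_of_signEquiv (U : Subgroup (absoluteGaloisGroup K)) [U.Normal] (hχU : ∀ u ∈ U, χ u = 1)
    (he : ∀ (σ : absoluteGaloisGroup K) (a : A), e (σ • a) = ((χ σ : ℤˣ) : ℤ) • σ • e a) (P : HeightOneSpectrum (𝓞 K) → Prop)
    (hLS : ∀ (T : Finset (HeightOneSpectrum (𝓞 K))), (∀ w ∈ T, P w) →
      ∀ τ : (w : HeightOneSpectrum (𝓞 K)) →
        DoubleCoset.Quotient (decomp (K := K) w : Set (absoluteGaloisGroup K)) (U : Set (absoluteGaloisGroup K)) → subgroupH1 (decompIn U w) A,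
      ∃ z : subgroupH1 U A,
        (∀ w ∈ T, ∀ Q : DoubleCoset.Quotient (decomp (K := K) w : Set (absoluteGaloisGroup K)) (U : Set (absoluteGaloisGroup K)),
          resOfLe A (inertiaIn_le_decompIn U w)
            (resH1Hom (decompInToH U w) (AddMonoidHom.id A) (fun _ _ ↦ rfl) (conjH1 U A Q.out z) - τ w Q) = 0) ∧
        (∀ w : HeightOneSpectrum (𝓞 K), w ∉ T → P w → ∀ σ : absoluteGaloisGroup K, conjH1 U A σ z ∈ unramifiedKer U A w)) :
    ∀ (T : Finset (HeightOneSpectrum (𝓞 K))), (∀ w ∈ T, P w) →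
      ∀ τ' : (w : HeightOneSpectrum (𝓞 K)) →
        DoubleCoset.Quotient (decomp (K := K) w : Set (absoluteGaloisGroup K)) (U : Set (absoluteGaloisGroup K)) → subgroupH1 (decompIn U w) A',
      ∃ z' : subgroupH1 U A',
        (∀ w ∈ T, ∀ Q : DoubleCoset.Quotient (decomp (K := K) w : Set (absoluteGaloisGroup K)) (U : Set (absoluteGaloisGroup K)),
          resOfLe A' (inertiaIn_le_decompIn U w)
            (resH1Hom (decompInToH U w) (AddMonoidHom.id A') (fun _ _ ↦ rfl) (conjH1 U A' Q.out z') - τ' w Q) = 0) ∧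
        (∀ w : HeightOneSpectrum (𝓞 K), w ∉ T → P w → ∀ σ : absoluteGaloisGroup K, conjH1 U A' σ z' ∈ unramifiedKer U A' w) := by
  intro T hT τ'
  -- the pushes `e_*`, `e⁻¹_*` on `H¹(U ∩ D_w, ·)`
  set ED : (w : HeightOneSpectrum (𝓞 K)) → subgroupH1 (decompIn U w) A →+ subgroupH1 (decompIn U w) A' :=
    fun w ↦ resH1Hom (ContinuousMonoidHom.id (decompIn U w)) e.toAddMonoidHom (compat_decompIn χ e U he hχU w) with hED
  set ED' : (w : HeightOneSpectrum (𝓞 K)) → subgroupH1 (decompIn U w) A' →+ subgroupH1 (decompIn U w) A :=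
    fun w ↦ resH1Hom (ContinuousMonoidHom.id (decompIn U w)) e.symm.toAddMonoidHom (compat_decompIn_symm χ e U he hχU w) with hED'
  have hEE' : ∀ w (c : subgroupH1 (decompIn U w) A'), ED w (ED' w c) = c := fun w c ↦
    push_push_symm e (compat_decompIn χ e U he hχU w) (compat_decompIn_symm χ e U he hχU w) c
  -- solve in `A` for the re-signed, pulled-back targets
  obtain ⟨z, hz, hz'⟩ := hLS T hT (fun w Q ↦ ED' w (((χ Q.out : ℤˣ) : ℤ) • τ' w Q))
  refine ⟨resH1Hom (ContinuousMonoidHom.id U) e.toAddMonoidHom (compat_U χ e U he hχU) z, fun w hw Q ↦ ?_, fun w hw hPw σ ↦ ?_⟩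
  · have h1 := hz w hw Q
    rw [conjH1_push_eq_sign_smul χ e U he hχU, AddMonoidHom.map_zsmul, resH1Hom_decompInToH_push χ e U he hχU w]
    have hτ : τ' w Q = ((χ Q.out : ℤˣ) : ℤ) • ED w (ED' w (((χ Q.out : ℤˣ) : ℤ) • τ' w Q)) := by
      rw [hEE', sign_smul_sign_smul]
    rw [hτ, ← zsmul_sub, AddMonoidHom.map_zsmul, hED, ← map_sub, resOfLe_push χ e U he hχU w, h1, map_zero, zsmul_zero]
  · rw [conjH1_push_eq_sign_smul χ e U he hχU]
    exact AddSubgroup.zsmul_mem _ ((mem_unramifiedKer_push_iff χ e U he hχU w _).2 (hz' w hw hPw σ)) _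

/-! ## §5. Character modules: `(LSₙ)(A_θ) ⟹ (LSₙ)(A_{θ′})` when `θ = θ′` on `U` -/

/-- **(LSₙ) for `A_θ` ⟹ (LSₙ) for `A_{θ′}` whenever the quadratic framed characters `θ, θ′` AGREE ON `U`** (as unit characters): the
`Γ_K`-actions on `A_θ = ℚ₂/ℤ₂(θ)`, `A_{θ′}` are the scalar signs `ε_θ, ε_{θ′} : Γ_K →* ℤˣ` (p706294), so ANY additive isomorphism
`e : A_θ ≃+ A_{θ′}` satisfies `e (σ • a) = χ(σ) • σ • e a` with `χ := ε_θ ε_{θ′}`, trivial on `U`; apply `locSurj_of_signEquiv`. The re-twist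
step of «B5-T»: `θ′ := θ ⊗ χ_{κ₂}` on `U = Gal(K̄/K^{(v̄)}_n)`, `n ≥ 1`. [cite: GreenbergLNM1716, §4 p. 107] [cite: KellerYin2024, §1.1] -/
theorem locSurj_charModule_of_unitChar_eq_on (θ θ' : FramedGaloisRep K (padicCoeffIntegers (∅ : Set (PadicAlgCl 2))) 1)
    (hθ : ∀ σ : absoluteGaloisGroup K, θ σ ^ 2 = 1) (hθ' : ∀ σ : absoluteGaloisGroup K, θ' σ ^ 2 = 1)
    (U : Subgroup (absoluteGaloisGroup K)) [U.Normal] (hU : ∀ u ∈ U, unitChar θ u = unitChar θ' u) (P : HeightOneSpectrum (𝓞 K) → Prop)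
    (hLS : ∀ (T : Finset (HeightOneSpectrum (𝓞 K))), (∀ w ∈ T, P w) →
      ∀ τ : (w : HeightOneSpectrum (𝓞 K)) →
        DoubleCoset.Quotient (decomp (K := K) w : Set (absoluteGaloisGroup K)) (U : Set (absoluteGaloisGroup K)) →
          subgroupH1 (decompIn U w) (charModule (∅ : Set (PadicAlgCl 2)) θ),
      ∃ z : subgroupH1 U (charModule (∅ : Set (PadicAlgCl 2)) θ),
        (∀ w ∈ T, ∀ Q : DoubleCoset.Quotient (decomp (K := K) w : Set (absoluteGaloisGroup K)) (U : Set (absoluteGaloisGroup K)),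
          resOfLe (charModule (∅ : Set (PadicAlgCl 2)) θ) (inertiaIn_le_decompIn U w)
            (resH1Hom (decompInToH U w) (AddMonoidHom.id (charModule (∅ : Set (PadicAlgCl 2)) θ)) (fun _ _ ↦ rfl)
              (conjH1 U (charModule (∅ : Set (PadicAlgCl 2)) θ) Q.out z) - τ w Q) = 0) ∧
        (∀ w : HeightOneSpectrum (𝓞 K), w ∉ T → P w →
          ∀ σ : absoluteGaloisGroup K, conjH1 U (charModule (∅ : Set (PadicAlgCl 2)) θ) σ z ∈
            unramifiedKer U (charModule (∅ : Set (PadicAlgCl 2)) θ) w)) :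
    ∀ (T : Finset (HeightOneSpectrum (𝓞 K))), (∀ w ∈ T, P w) →
      ∀ τ' : (w : HeightOneSpectrum (𝓞 K)) →
        DoubleCoset.Quotient (decomp (K := K) w : Set (absoluteGaloisGroup K)) (U : Set (absoluteGaloisGroup K)) →
          subgroupH1 (decompIn U w) (charModule (∅ : Set (PadicAlgCl 2)) θ'),
      ∃ z' : subgroupH1 U (charModule (∅ : Set (PadicAlgCl 2)) θ'),
        (∀ w ∈ T, ∀ Q : DoubleCoset.Quotient (decomp (K := K) w : Set (absoluteGaloisGroup K)) (U : Set (absoluteGaloisGroup K)),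
          resOfLe (charModule (∅ : Set (PadicAlgCl 2)) θ') (inertiaIn_le_decompIn U w)
            (resH1Hom (decompInToH U w) (AddMonoidHom.id (charModule (∅ : Set (PadicAlgCl 2)) θ')) (fun _ _ ↦ rfl)
              (conjH1 U (charModule (∅ : Set (PadicAlgCl 2)) θ') Q.out z') - τ' w Q) = 0) ∧
        (∀ w : HeightOneSpectrum (𝓞 K), w ∉ T → P w →
          ∀ σ : absoluteGaloisGroup K, conjH1 U (charModule (∅ : Set (PadicAlgCl 2)) θ') σ z' ∈
            unramifiedKer U (charModule (∅ : Set (PadicAlgCl 2)) θ') w) := by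
  obtain ⟨ε, -, hε1, -, hεact⟩ := KummerUDict.exists_signHom_of_sq_eq_one θ hθ
  obtain ⟨ε', -, hε'1, -, hε'act⟩ := KummerUDict.exists_signHom_of_sq_eq_one θ' hθ'
  -- the relative sign `χ = ε ε′` is trivial on `U`
  have hχU : ∀ u ∈ U, (ε * ε') u = 1 := by
    intro u hu
    have hiff : ε u = 1 ↔ ε' u = 1 := by rw [hε1, hU u hu, ← hε'1]
    have heq : ε u = ε' u := by
      rcases Int.units_eq_one_or (ε u) with h | h <;> rcases Int.units_eq_one_or (ε' u) with h' | h'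
      · rw [h, h']
      · exact absurd (hiff.1 h) (by rw [h']; decide)
      · exact absurd (hiff.2 h') (by rw [h]; decide)
      · rw [h, h']
    rw [MonoidHom.mul_apply, heq, Int.units_mul_self]
  -- any additive isomorphism is `χ`-twisted equivariant
  set e : charModule (∅ : Set (PadicAlgCl 2)) θ ≃+ charModule (∅ : Set (PadicAlgCl 2)) θ' :=
    (charModuleEquiv θ).trans (charModuleEquiv θ').symm with hedef
  have he : ∀ (σ : absoluteGaloisGroup K) (a : charModule (∅ : Set (PadicAlgCl 2)) θ),
      e (σ • a) = (((ε * ε') σ : ℤˣ) : ℤ) • σ • e a := by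
    intro σ a
    rw [hεact, _root_.map_zsmul, hε'act, MonoidHom.mul_apply, Units.val_mul, mul_zsmul, sign_smul_sign_smul]
  exact locSurj_of_signEquiv (ε * ε') e U hχU he P hLS

end Summit.BirchSwinnertonDyer.BirchSwinnertonDyer.Theorems.PrintCf2.SignTwist

end
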